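import Literature.AnabelianGeometry.SemiGraphs.TemperedCuspOmission
import Literature.AnabelianGeometry.SemiGraphs.TemperedReconstruction
import Literature.AnabelianGeometry.SemiGraphs.UniversalCoveringObj
import HarnessLib

/-!
# The hypotheses of [SemiAnbd] Prop. 3.6 / Thm. 3.7 / Cor. 3.9 pass to the restriction along a CUSP
# OMISSION ([SemiAnbd] §1 p. 13 "omitting all of the open edges"; [IUTchI] §2 p. 44)

Mochizuki, *Semi-graphs of anabelioids*, Publ. RIMS **42** (2006) [MochizukiSemiAnbd2006], §1 p. 13 (the
maximal subgraph: "the sub-semi-graph obtained by omitting all of the open edges"), Def. 2.3 pp. 24–25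
(approximators, quasi-coherence), Def. 2.4 pp. 25–26 (elevated, verticially slim, aloof, estranged),
Prop. 3.6 p. 38 / Thm. 3.7 p. 40 / Cor. 3.9 p. 42 (hypothesis bundles: `Prop36Hypotheses`, `Thm37Hypotheses`,
`Cor39Hypotheses`; Cor. 3.9 asks for a GRAPH of anabelioids); Mochizuki, *Inter-universal Teichmüller theory
I*, §2 p. 44: "the omission of cuspidal edges clearly does not affect … the tempered … fundamental groups"
[cite: Mochizuki2012, §2 p.44].

Sequel (abc-iut cell, block F, seat abc-iut-f-177; witness / proof-structure lane) of abc-iut row W4-30's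
`TemperedCoveringsSubgraph(BTemp).lean` / `TemperedCuspOmission.lean` (restriction `𝒢.restrict H`,
`B^temp(𝒢) ≌ B^temp(𝒢_ℍ)`, `Π^tp` unchanged) and of the one-off transfer for the cusp witness
(`IwahoriWitness.restrict_cuspOmission_thm37Hypotheses`, `TemperedSpecialFibreReductionsSchemaS3.lean`):
here the HYPOTHESIS BUNDLES themselves are transported, for an arbitrary `𝒢` and cusp omission `H`:

* any sub-semi-graph: `IsCountable`, `IsOfInjectiveType`, `IsVerticiallySlim`, `IsTotallyAloof`,
  `IsTotallyEstranged` restrict (same groups, a sub-family of the branches); approximators restrict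
  (`Approximator.restrictSub`), hence `IsTotallyElevated` restricts;
* cusp omission: `HasVertex`, `IsConnected` (tree: `IsCuspOmission.isConnected`), `IsQuasiCoherent`
  (extend the prescribed finite coverings by the EMPTY covering over the omitted cusps, approximate in `𝒢`,
  restrict the approximator) and `IsGaloisCountable` (restrict the countable splitting family; a finite
  covering of `𝒢_ℍ` extends along the cusps, `CovObj.extendAlongCusps`, and splittings restrict);
* assembled: **`Prop36Hypotheses.restrict_of_isCuspOmission`**, **`Thm37Hypotheses.restrict_of_isCuspOmission`**,
  and — since the maximal subgraph of a connected semi-graph with a vertex is a cusp omission and a GRAPH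
  (tree: `maximalSubgraph_isCuspOmission_of_isConnected`, `isGraph_maximalSubgraph`) —
  **`cor39Hypotheses_restrict_maximalSubgraph : 𝒢.Thm37Hypotheses → Cor39Hypotheses (𝒢|_{𝔾_max})`**: the
  form in which [SemiAnbd] Cor. 3.9 (which binds graphs of anabelioids) is applied to the semi-graph of
  anabelioids `G^c` WITH cusps of a pointed stable curve in the proof of Cor. 3.11 (p. 46: "`G[□]` … the
  graph of anabelioids [without compact structure!]").

Proof-structure file: nothing of the paper is asserted or strengthened; no instance, no notation, no `Prop`
fact; nothing here bears on [IUTchIII] Cor. 3.12.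
-/

noncomputable section

namespace Literature.AnabelianGeometry.SemiGraphs

namespace ProfiniteSemiGraph

open CategoryTheory Topology
open Literature.AlgebraicGeometry.Frobenioids (IsSlimGroup)

universe u

variable {𝒢 : ProfiniteSemiGraph.{u}}

/-! ### Clauses that restrict to ANY sub-semi-graph -/

/-- Countability restricts. [cite: MochizukiSemiAnbd2006, §1 p.11] -/
theorem IsCountable.restrictSub (h : 𝒢.IsCountable) (H : 𝒢.graph.Subgraph) :
    (𝒢.restrict H).IsCountable := by
  obtain ⟨hV, hE⟩ := h
  exact ⟨Subtype.countable, Subtype.countable⟩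

/-- Injective type restricts (the branch maps of `𝒢_ℍ` are among those of `𝒢`).
[cite: MochizukiSemiAnbd2006, Def 2.1 p.22] -/
theorem IsOfInjectiveType.restrictSub (h : ProfiniteSemiGraph.IsOfInjectiveType 𝒢)
    (H : 𝒢.graph.Subgraph) :
    ProfiniteSemiGraph.IsOfInjectiveType (ProfiniteSemiGraph.restrict 𝒢 H) :=
  fun b v _ => h b.1 v.1 _

/-- Verticial slimness restricts (same vertex groups). [cite: MochizukiSemiAnbd2006, Def 2.4(ii) p.25] -/
theorem IsVerticiallySlim.restrictSub (h : 𝒢.IsVerticiallySlim) (H : 𝒢.graph.Subgraph) :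
    (𝒢.restrict H).IsVerticiallySlim :=
  fun v => h v.1

/-- The branch subgroups of `𝒢_ℍ` are those of `𝒢` (definitional). [cite: MochizukiSemiAnbd2006, §2 p.23] -/
theorem restrict_branchSubgroup (H : 𝒢.graph.Subgraph) (b : (𝒢.restrict H).graph.Branch)
    (v : (𝒢.restrict H).graph.Vertex) (hb : (𝒢.restrict H).graph.abuts b = some v) :
    (𝒢.restrict H).branchSubgroup b v hb = 𝒢.branchSubgroup b.1 v.1 ((H.abuts_eq_some_iff b v).mp hb) :=
  rfl

/-- Aloofness of an edge restricts. [cite: MochizukiSemiAnbd2006, Def 2.4(iv) p.26] -/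
theorem IsAloofEdge.restrictSub {H : 𝒢.graph.Subgraph} (e : (𝒢.restrict H).graph.Edge)
    (h : 𝒢.IsAloofEdge e.1) : (𝒢.restrict H).IsAloofEdge e := by
  intro b hbe v hb b' hb' g hg
  rw [restrict_branchSubgroup] at hg ⊢
  rw [restrict_branchSubgroup]
  refine h b.1 (congrArg Subtype.val hbe) v.1 _ b'.1 _ g ?_
  rcases hg with hne | hg
  · exact Or.inl fun heq => hne (Subtype.ext heq)
  · exact Or.inr hg

/-- Total aloofness restricts. [cite: MochizukiSemiAnbd2006, Def 2.4(iv) p.26] -/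
theorem IsTotallyAloof.restrictSub (h : 𝒢.IsTotallyAloof) (H : 𝒢.graph.Subgraph) :
    (𝒢.restrict H).IsTotallyAloof :=
  fun e => IsAloofEdge.restrictSub e (h e.1)

/-- Total estrangement restricts. [cite: MochizukiSemiAnbd2006, Def 2.4(iv) p.26] -/
theorem IsTotallyEstranged.restrictSub (h : 𝒢.IsTotallyEstranged) (H : 𝒢.graph.Subgraph) :
    (𝒢.restrict H).IsTotallyEstranged := by
  intro e
  refine ⟨IsAloofEdge.restrictSub e (h e.1).1, ?_⟩
  intro b hbe v hb b' hb' g hg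
  rw [restrict_branchSubgroup] at hg ⊢
  rw [restrict_branchSubgroup]
  refine (h e.1).2 b.1 (congrArg Subtype.val hbe) v.1 _ b'.1 _ g ?_
  rcases hg with hne | hg
  · exact Or.inl fun heq => hne (Subtype.ext heq)
  · exact Or.inr hg

/-- **Restriction of an approximator** to a sub-semi-graph: the same finite groups and homomorphisms
over the components of `ℍ` (Def. 2.3 (i)(ii)). [cite: MochizukiSemiAnbd2006, Def 2.3 pp.24-25] -/
def Approximator.restrictSub (A : 𝒢.Approximator) (H : 𝒢.graph.Subgraph) : (𝒢.restrict H).Approximator where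
  FV v := A.FV v.1
  FE e := A.FE e.1
  πV v := A.πV v.1
  πE e := A.πE e.1
  isOpen_ker_πV v := A.isOpen_ker_πV v.1
  isOpen_ker_πE e := A.isOpen_ker_πE e.1
  brF b v hb := A.brF b.1 v.1 ((H.abuts_eq_some_iff b v).mp hb)
  brF_injective b v hb := A.brF_injective b.1 v.1 _
  comm b v hb := A.comm b.1 v.1 _
  bounded := by
    obtain ⟨M, hM, hdvd⟩ := A.bounded
    exact ⟨M, hM, fun v => hdvd v.1⟩

/-- The restriction of a `π₁`-epimorphic approximator is `π₁`-epimorphic.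
[cite: MochizukiSemiAnbd2006, Def 2.3(ii) p.25] -/
theorem Approximator.IsPiOneEpimorphic.restrictSub {A : 𝒢.Approximator} (h : A.IsPiOneEpimorphic)
    (H : 𝒢.graph.Subgraph) : (A.restrictSub H).IsPiOneEpimorphic :=
  ⟨fun v => h.1 v.1, fun e => h.2 e.1⟩

/-- Total elevation restricts (the branches of `ℍ` at a vertex are among those of `𝔾`; restrict the
approximator). [cite: MochizukiSemiAnbd2006, Def 2.4(i) p.25] -/
theorem IsTotallyElevated.restrictSub (h : 𝒢.IsTotallyElevated) (H : 𝒢.graph.Subgraph) :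
    (𝒢.restrict H).IsTotallyElevated := by
  intro v M
  obtain ⟨A, hA, N, hN, hmeet⟩ := h v.1 M
  exact ⟨A.restrictSub H, hA.restrictSub H, N, hN, fun b hb g => hmeet b.1 _ g⟩

/-! ### Clauses that restrict along a cusp omission -/

variable {H : 𝒢.graph.Subgraph}

/-- A cusp omission keeps a vertex. [cite: MochizukiSemiAnbd2006, §1 p.13] -/
theorem HasVertex.restrict_of_isCuspOmission (h : 𝒢.HasVertex) (hH : H.IsCuspOmission) :
    (𝒢.restrict H).HasVertex := by
  obtain ⟨v⟩ := h
  exact ⟨hH.vtx v⟩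

/-- Omitting cusps preserves connectedness (tree: `IsCuspOmission.isConnected`).
[cite: MochizukiSemiAnbd2006, §1 p.13] -/
theorem IsConnected.restrict_of_isCuspOmission (h : 𝒢.IsConnected) (hH : H.IsCuspOmission) :
    (𝒢.restrict H).IsConnected :=
  hH.isConnected h

/-- **Quasi-coherence passes to a cusp omission** (Def. 2.3 (iii)): prescribe the given finite coverings over
the components of `ℍ` and the EMPTY covering over each omitted cusp, approximate in `𝒢`, restrict the
approximator. [cite: MochizukiSemiAnbd2006, Def 2.3(iii) p.25] -/
theorem IsQuasiCoherent.restrict_of_isCuspOmission (h : 𝒢.IsQuasiCoherent) (hH : H.IsCuspOmission) :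
    (𝒢.restrict H).IsQuasiCoherent := by
  classical
  intro M HV HE hV hE
  -- the prescribed coverings, extended by the empty covering over the omitted cusps
  let HV' : ∀ v : 𝒢.graph.Vertex, BTemp (𝒢.Gv v) := fun v => HV (hH.vtx v)
  let HE' : ∀ e : 𝒢.graph.Edge, BTemp (𝒢.Ge e) := fun e =>
    if he : e ∈ H.edges then HE ⟨e, he⟩ else BTemp.trivialObj (𝒢.Ge e) PEmpty
  have hV' : ∀ v, Nat.card (HV' v).obj.V ≤ M ∧ Finite (HV' v).obj.V := fun v => hV (hH.vtx v)
  have hE' : ∀ e, Nat.card (HE' e).obj.V ≤ M ∧ Finite (HE' e).obj.V := by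
    intro e
    by_cases he : e ∈ H.edges
    · have heq : HE' e = HE ⟨e, he⟩ := dif_pos he
      rw [heq]
      exact hE ⟨e, he⟩
    · have heq : HE' e = BTemp.trivialObj (𝒢.Ge e) PEmpty := dif_neg he
      rw [heq]
      exact ⟨by simp [BTemp.trivialObj], inferInstanceAs (Finite PEmpty)⟩
  obtain ⟨A, hAV, hAE⟩ := h M HV' HE' hV' hE'
  refine ⟨A.restrictSub H, fun v g hg x => hAV v.1 g hg x, fun e g hg => ?_⟩
  have heq : HE' e.1 = HE e := dif_pos e.2
  have key : ∀ (Y : BTemp (𝒢.Ge e.1)), Y = HE e →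
      (∀ x : Y.obj.V, Y.obj.ρ g x = x) → ∀ x : (HE e).obj.V, (HE e).obj.ρ g x = x := by
    rintro _ rfl hY
    exact hY
  exact key (HE' e.1) heq (hAE e.1 g hg)

/-- Splitting of the restricted covering over an edge of `ℍ`: transport along `S_e = (S|_ℍ extended)_e`.
[cite: MochizukiSemiAnbd2006, Def 3.5(ii) p.37] -/
private theorem splits_transport {G : Type u} [Group G] [TopologicalSpace G] {Y Z : BTemp G}
    (hYZ : Y = Z) (g : G) (hY : ∀ s : Y.obj.V, Y.obj.ρ g s = s) : ∀ s : Z.obj.V, Z.obj.ρ g s = s := by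
  subst hYZ
  exact hY

/-- **Galois-countability passes to a cusp omission** ([IUTchI] Rmk. 2.5.3 (i) (T2)): restrict the countable
splitting family of `𝒢`; a finite covering of `𝒢_ℍ` extends along the cusps to a finite covering of `𝒢`
(`CovObj.extendAlongCusps`), and a splitting of the extension restricts to a splitting of the given
covering. [cite: Mochizuki2012, IUTchI Rmk 2.5.3 (i) (T2), p. 52] -/
theorem IsGaloisCountable.restrict_of_isCuspOmission (h : 𝒢.IsGaloisCountable) (hH : H.IsCuspOmission) :
    (𝒢.restrict H).IsGaloisCountable := by
  obtain ⟨hc, F, hF, hsplit⟩ := h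
  refine ⟨hc.restrictSub H, fun i => (𝒢.covRestrict H).obj (F i),
    fun i => ⟨(hF i).1.covRestrict H, (hF i).2.covRestrict H⟩, fun S' hS' => ?_⟩
  obtain ⟨i, hiV, hiE⟩ := hsplit (CovObj.extendAlongCusps hH S') (hS'.extendAlongCusps hH)
  refine ⟨i, fun w x g hgx s => hiV w.1 x g hgx s, fun e x g hgx => ?_⟩
  exact splits_transport (CovObj.extendSE_of_mem hH S' e.2) g (hiE e.1 x g hgx)

/-! ### The bundles -/

/-- **The hypotheses of [SemiAnbd] Prop. 3.6 pass to the restriction along a cusp omission.**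
[cite: MochizukiSemiAnbd2006, Prop 3.6 p.38] -/
theorem Prop36Hypotheses.restrict_of_isCuspOmission (h : 𝒢.Prop36Hypotheses) (hH : H.IsCuspOmission) :
    (𝒢.restrict H).Prop36Hypotheses where
  isConnected := h.isConnected.restrict_of_isCuspOmission hH
  isCountable := h.isCountable.restrictSub H
  isGaloisCountable := h.isGaloisCountable.restrict_of_isCuspOmission hH
  hasVertex := h.hasVertex.restrict_of_isCuspOmission hH
  isOfInjectiveType := h.isOfInjectiveType.restrictSub H
  isQuasiCoherent := h.isQuasiCoherent.restrict_of_isCuspOmission hH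
  isTotallyElevated := h.isTotallyElevated.restrictSub H
  isTotallyAloof := h.isTotallyAloof.restrictSub H
  isVerticiallySlim := h.isVerticiallySlim.restrictSub H

/-- **The hypotheses of [SemiAnbd] Thm. 3.7 pass to the restriction along a cusp omission.**
[cite: MochizukiSemiAnbd2006, Thm 3.7 p.40] -/
theorem Thm37Hypotheses.restrict_of_isCuspOmission (h : 𝒢.Thm37Hypotheses) (hH : H.IsCuspOmission) :
    (𝒢.restrict H).Thm37Hypotheses where
  toProp36Hypotheses := h.toProp36Hypotheses.restrict_of_isCuspOmission hH
  isTotallyEstranged := h.isTotallyEstranged.restrictSub H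

/-- For `𝒢` satisfying the hypotheses of Prop. 3.6 the maximal subgraph (omit all open edges) is a cusp
omission (`𝒢` is connected with a vertex). [cite: MochizukiSemiAnbd2006, §1 p.13] -/
theorem Prop36Hypotheses.maximalSubgraph_isCuspOmission (h : 𝒢.Prop36Hypotheses) :
    𝒢.graph.maximalSubgraph.IsCuspOmission :=
  SemiGraph.maximalSubgraph_isCuspOmission_of_isConnected h.isConnected h.hasVertex

/-- **The hypotheses of [SemiAnbd] Cor. 3.9 hold for the maximal subgraph `𝒢|_{𝔾_max}` (all open edges
omitted) of any `𝒢` satisfying the hypotheses of Thm. 3.7** — the restriction is a GRAPH of anabelioids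
(every branch abuts) and the Thm. 3.7 hypotheses pass to it; this is the form in which Cor. 3.9 is applied
to "`G[□]` … the graph of anabelioids [without compact structure!]" of a special fibre WITH cusps in the
proof of Cor. 3.11 (p. 46). [cite: MochizukiSemiAnbd2006, Cor 3.9 p.42] -/
theorem cor39Hypotheses_restrict_maximalSubgraph (h : 𝒢.Thm37Hypotheses) :
    Cor39Hypotheses (𝒢.restrict 𝒢.graph.maximalSubgraph) where
  toProp36Hypotheses :=
    h.toProp36Hypotheses.restrict_of_isCuspOmission h.toProp36Hypotheses.maximalSubgraph_isCuspOmission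
  isTotallyEstranged := h.isTotallyEstranged.restrictSub _
  isGraph := SemiGraph.isGraph_maximalSubgraph 𝒢.graph

/-- **… together with a tempered fundamental group of the SAME underlying group** ("`Π^tp` unchanged by
cusp omission", [IUTchI] §2 p. 44; tree: `TemperedPiChart.transport` along the cusp-omission
equivalence): for every chart `c` of `𝒢` there is a chart of `𝒢|_{𝔾_max}` with group `c.G`.
[cite: Mochizuki2012, §2 p.44] -/
theorem exists_cor39Hypotheses_and_chart_restrict_maximalSubgraph (h : 𝒢.Thm37Hypotheses)
    (c : TemperedPiChart 𝒢) :
    Cor39Hypotheses (𝒢.restrict 𝒢.graph.maximalSubgraph) ∧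
      ∃ c' : TemperedPiChart (𝒢.restrict 𝒢.graph.maximalSubgraph), c'.G = c.G :=
  ⟨cor39Hypotheses_restrict_maximalSubgraph h,
    exists_temperedPiChart_restrict_G_eq h.toProp36Hypotheses.maximalSubgraph_isCuspOmission c⟩

end ProfiniteSemiGraph

end Literature.AnabelianGeometry.SemiGraphs

end
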